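import Literature.NumberTheory.Transcendental.GaGmSubgroups
import HarnessLib

/-!
# Philippon's descent at `T = 0` on `𝔾ₐ × 𝔾ₘⁿ` (the §5 argument behind `Philippon1986_GaGm_P1n`)

Topic `Literature/NumberTheory/Transcendental`. The combinatorial-geometric heart of the
multiplicity-free case of Philippon's zero estimate (Philippon 1986, §5, pp. 380–383, specialised
to `T = 0`, `G = 𝔾ₐ × 𝔾ₘⁿ ⊂ (ℙ¹)ⁿ⁺¹`, `cᵢ = 1`), on the toolkit `GaGmZariski` / `GaGmBezout` /
`GaGmSubgroups`. Everything here is PROVED; no named facts.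

`GaGm.exists_obstruction_subgroup`: let `D₀, D₁ ≥ 1`, `Σ ⊆ G(ℂ)` finite with `e ∈ Σ`, and
`P ≠ 0` a box polynomial (`P ∈ Box(D₀, D₁; 1)`) vanishing on `Σ(n+1)`. Then there is an
irreducible closed subgroup `H₀ ≤ G(ℂ)` which (a) is a component of the zero set of a family of
box polynomials `F ⊆ Box(D₀, D₁; 1)` ("incomplètement défini par des équations de multidegrés
`≤ (D₀, D₁, …, D₁)`"), (b) is contained in a translate of `Z(P)`, and (c) satisfies the Bézout
count `card((Σ·H₀)/H₀) · mult_{D₀,D₁}(H₀) ≤ (n+1)! D₀ D₁ⁿ`.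

Proof (Philippon §5 at `T = 0`): the zero sets `Z_r = {g ; P(γg) = 0 ∀ γ ∈ Σ(r)}`,
`0 ≤ r ≤ n + 1`, decrease, contain `e`, and `Z_0 = Z(P) ≠ G`, so `dim Z_0 ≤ n` and two consecutive
dimensions agree, `dim Z_r = dim Z_{r+1}` (`Descent.exists_eq_succ_of_antitone`). A top-dimensional
component `V` of `Z_{r+1}` has all its `Σ`-translates among the top-dimensional components of
`Z_r` (`σ Z_{r+1} ⊆ Z_r`). Let `E = {g ; gV ⊆ Z_r}` — the zero set of the translates
`f(v ·)`, `v ∈ V`, `f` a generator of `Z_r`, all box polynomials — and `St = {g ; gV = V}` the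
stabiliser of `V` (`MulAction.stabilizer`, a closed subgroup: `Descent.isClosedG_stabilizer`), `H₀ = St⁰` its identity component
(`GaGm.idComp`). Then `Σ ⊆ E`, `E` is a finite union of cosets of `St` (they correspond to
components of `Z_r`), hence of `H₀` (finite index), so `dim E = dim H₀` and every coset `σH₀`,
`σ ∈ Σ`, is a top-dimensional component of `E`; the Bézout inequality
`GaGm.sum_mult_le_of_subset_Box` for `E` and translation invariance of `mult` give (c); (b) holds
with the translate by any point of `V ⊆ Z(P)`; (a) holds with `F` the generators of `E`.

## References

* P. Philippon, *Lemmes de zéros dans les groupes algébriques commutatifs*, Bull. Soc. Math.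
  France 114 (1986), 355–383, §5 pp. 380–383 (the ideals `I_r`, the set `H_V(0)`, Lemme 5.1).
  [Philippon1986]
* Yu. V. Nesterenko, P. Philippon (eds.), LNM 1752 (2001), Ch. 11 (D. Roy), §4 (proof of
  Thm 4.1). [NesterenkoPhilippon2001]
-/

noncomputable section

open MvPolynomial
open scoped Pointwise

namespace Literature.NumberTheory.Transcendental

namespace GaGm

variable {n : ℕ}

namespace Descent

/-! ### Sumsets -/

/-- `e ∈ Σ(r)` when `e ∈ Σ`. [folklore] -/
theorem one_mem_sumset {S : Set (GaGm n)} (h1 : (1 : GaGm n) ∈ S) (r : ℕ) : (1 : GaGm n) ∈ sumset S r :=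
  ⟨fun _ => 1, fun _ => h1, by simp⟩

/-- `Σ(r) · Σ ⊆ Σ(r+1)`. [folklore] -/
theorem mul_mem_sumset_succ {S : Set (GaGm n)} {r : ℕ} {γ σ : GaGm n} (hγ : γ ∈ sumset S r)
    (hσ : σ ∈ S) : γ * σ ∈ sumset S (r + 1) := by
  obtain ⟨τ, hτ, rfl⟩ := hγ
  refine ⟨Fin.snoc τ σ, fun i => ?_, ?_⟩
  · refine Fin.lastCases ?_ (fun j => ?_) i
    · simpa using hσ
    · simpa using hτ j
  · rw [Fin.prod_univ_castSucc]
    simp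

/-- `Σ(r) ⊆ Σ(r+1)` when `e ∈ Σ`. [folklore] -/
theorem sumset_subset_succ {S : Set (GaGm n)} (h1 : (1 : GaGm n) ∈ S) (r : ℕ) :
    sumset S r ⊆ sumset S (r + 1) := fun γ hγ => by
  simpa using mul_mem_sumset_succ hγ h1

/-! ### The chain of zero sets `Z_r = {g ; P(γ g) = 0 ∀ γ ∈ Σ(r)}` -/

/-- The translates `P(γ ·)`, `γ ∈ Σ(r)`. [folklore] -/
def gens (S : Set (GaGm n)) (P : MvPolynomial (Fin (n + 1)) ℂ) (r : ℕ) : Set (MvPolynomial (Fin (n + 1)) ℂ) :=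
  (fun γ => shift γ P) '' sumset S r

/-- The zero sets `Z_r` of Philippon's ideals `I_{r+1}` at `T = 0`. [folklore] -/
def Zs (S : Set (GaGm n)) (P : MvPolynomial (Fin (n + 1)) ℂ) (r : ℕ) : Set (GaGm n) :=
  zeroSet (gens S P r)

/-- The generators are box polynomials. [folklore] -/
theorem gens_subset_Box {D₀ D₁ : ℕ} {S : Set (GaGm n)} {P : MvPolynomial (Fin (n + 1)) ℂ}
    (hP : P ∈ Box (n := n) D₀ D₁ 1) (r : ℕ) : gens S P r ⊆ Box (n := n) D₀ D₁ 1 := by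
  rintro _ ⟨γ, -, rfl⟩
  exact shift_mem_Box γ hP

/-- Membership in `Z_r`. [folklore] -/
theorem mem_Zs_iff {S : Set (GaGm n)} {P : MvPolynomial (Fin (n + 1)) ℂ} {r : ℕ} {g : GaGm n} :
    g ∈ Zs S P r ↔ ∀ γ ∈ sumset S r, evalAt P (γ * g) = 0 := by
  simp only [Zs, gens, mem_zeroSet_iff, Set.forall_mem_image, evalAt_shift]

/-- `Z_r` is closed. [folklore] -/
theorem isClosedG_Zs (S : Set (GaGm n)) (P : MvPolynomial (Fin (n + 1)) ℂ) (r : ℕ) : IsClosedG (Zs S P r) :=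
  isClosedG_zeroSet _

/-- `Z_{r+1} ⊆ Z_r`. [folklore] -/
theorem Zs_succ_subset {S : Set (GaGm n)} (h1 : (1 : GaGm n) ∈ S) (P : MvPolynomial (Fin (n + 1)) ℂ) (r : ℕ) :
    Zs S P (r + 1) ⊆ Zs S P r := fun g hg => by
  rw [mem_Zs_iff] at hg ⊢
  exact fun γ hγ => hg γ (sumset_subset_succ h1 r hγ)

/-- `Z_{r'} ⊆ Z_r` for `r ≤ r'`. [folklore] -/
theorem Zs_antitone {S : Set (GaGm n)} (h1 : (1 : GaGm n) ∈ S) (P : MvPolynomial (Fin (n + 1)) ℂ) {r r' : ℕ}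
    (h : r ≤ r') : Zs S P r' ⊆ Zs S P r := by
  induction h with
  | refl => exact le_rfl
  | step _ ih => exact (Zs_succ_subset h1 P _).trans ih

/-- **`σ Z_{r+1} ⊆ Z_r` for `σ ∈ Σ`.** [folklore] -/
theorem smul_Zs_succ_subset {S : Set (GaGm n)} {σ : GaGm n} (hσ : σ ∈ S) (P : MvPolynomial (Fin (n + 1)) ℂ)
    (r : ℕ) : σ • Zs S P (r + 1) ⊆ Zs S P r := by
  rintro _ ⟨g, hg, rfl⟩
  dsimp only
  rw [mem_Zs_iff] at hg ⊢
  intro γ hγ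
  rw [smul_eq_mul, ← mul_assoc]
  exact hg _ (mul_mem_sumset_succ hγ hσ)

/-- `e ∈ Z_{n+1}` when `P` vanishes on `Σ(n+1)`. [folklore] -/
theorem one_mem_Zs {S : Set (GaGm n)} {P : MvPolynomial (Fin (n + 1)) ℂ} {r : ℕ}
    (hvan : ∀ g ∈ sumset S r, evalAt P g = 0) : (1 : GaGm n) ∈ Zs S P r := by
  rw [mem_Zs_iff]
  intro γ hγ
  rw [mul_one]; exact hvan γ hγ

/-- `Z_0 = Z(P)`. [folklore] -/
theorem mem_Zs_zero_iff {S : Set (GaGm n)} {P : MvPolynomial (Fin (n + 1)) ℂ} {g : GaGm n} :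
    g ∈ Zs S P 0 ↔ evalAt P g = 0 := by
  rw [mem_Zs_iff, sumset_zero]
  simp

/-! ### Pigeonhole on dimensions -/

/-- An antitone sequence `d 0 ≥ d 1 ≥ ⋯` of naturals with `d 0 ≤ n` has two equal consecutive
terms among the first `n + 2`. [folklore] -/
theorem exists_eq_succ_of_antitone {n : ℕ} {d : ℕ → ℕ} (hd : ∀ r, d (r + 1) ≤ d r) (hb : d 0 ≤ n) :
    ∃ r, r ≤ n ∧ d r = d (r + 1) := by
  by_contra h
  push Not at h
  have key : ∀ k, k ≤ n + 1 → d k + k ≤ d 0 := by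
    intro k hk
    induction k with
    | zero => simp
    | succ k ih =>
      have h1 := ih (by omega)
      have h2 : d (k + 1) < d k := lt_of_le_of_ne (hd k) (Ne.symm (h k (by omega)))
      omega
  have := key (n + 1) le_rfl
  omega

/-! ### The stabiliser of an irreducible closed set -/

/-- `gV ⊆ V` forces `gV = V` for irreducible closed `V`. [folklore] -/
theorem smul_eq_of_smul_subset {V : Set (GaGm n)} (hV : IsIrred V) {g : GaGm n} (h : g • V ⊆ V) : g • V = V :=
  hV.eq_of_subset_of_dimG_eq (hV.smul g).isClosedG (hV.nonempty.smul_set) h (dimG_smul g V)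

/-- `gV ⊆ V` already puts `g` in the stabiliser `MulAction.stabilizer G V = {g ; gV = V}` of an
irreducible closed `V`. [folklore] -/
theorem mem_stabilizer_of_smul_subset {V : Set (GaGm n)} (hV : IsIrred V) {g : GaGm n} (h : g • V ⊆ V) :
    g ∈ MulAction.stabilizer (GaGm n) V :=
  MulAction.mem_stabilizer_iff.mpr (smul_eq_of_smul_subset hV h)

/-- The stabiliser of an irreducible closed `V` is the zero set of the translates `f(v ·)`, `v ∈ V`,
`f ∈ 𝔍(V)`. [folklore] -/
theorem coe_stabilizer_eq_zeroSet {V : Set (GaGm n)} (hV : IsIrred V) :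
    ((MulAction.stabilizer (GaGm n) V : Subgroup (GaGm n)) : Set (GaGm n)) =
      zeroSet (Set.image2 (fun v f => shift v f) V (vanishing V : Set (MvPolynomial (Fin (n + 1)) ℂ))) := by
  ext g
  rw [SetLike.mem_coe, MulAction.mem_stabilizer_iff]
  simp only [mem_zeroSet_iff, Set.forall_mem_image2, evalAt_shift]
  constructor
  · intro h v hv f hf
    exact hf (v * g) (h.le ⟨v, hv, by dsimp only; rw [smul_eq_mul, mul_comm]⟩)
  · intro h
    refine smul_eq_of_smul_subset hV ?_
    rintro _ ⟨v, hv, rfl⟩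
    dsimp only
    rw [← hV.isClosedG.eq]
    intro f hf
    rw [smul_eq_mul, mul_comm]
    exact h v hv f hf

/-- The stabiliser of an irreducible closed set is closed. [folklore] -/
theorem isClosedG_stabilizer {V : Set (GaGm n)} (hV : IsIrred V) :
    IsClosedG ((MulAction.stabilizer (GaGm n) V : Subgroup (GaGm n)) : Set (GaGm n)) := by
  rw [coe_stabilizer_eq_zeroSet hV]; exact isClosedG_zeroSet _

/-! ### The transporter `E = {g ; gV ⊆ Z}` -/

/-- The translates `f(v ·)`, `v ∈ V`, `f ∈ F`: generators of the transporter of `V` into `Z(F)`.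
[folklore] -/
def transGens (V : Set (GaGm n)) (F : Set (MvPolynomial (Fin (n + 1)) ℂ)) : Set (MvPolynomial (Fin (n + 1)) ℂ) :=
  Set.image2 (fun v f => shift v f) V F

/-- The generators of the transporter are box polynomials if `F` is. [folklore] -/
theorem transGens_subset_Box {D₀ D₁ : ℕ} {V : Set (GaGm n)} {F : Set (MvPolynomial (Fin (n + 1)) ℂ)}
    (hF : F ⊆ Box (n := n) D₀ D₁ 1) : transGens V F ⊆ Box (n := n) D₀ D₁ 1 := by
  rintro _ ⟨v, -, f, hf, rfl⟩
  exact shift_mem_Box v (hF hf)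

/-- Membership in the transporter `Z(transGens V F) = {g ; gV ⊆ Z(F)}`. [folklore] -/
theorem mem_zeroSet_transGens_iff {V : Set (GaGm n)} {F : Set (MvPolynomial (Fin (n + 1)) ℂ)} {g : GaGm n} :
    g ∈ zeroSet (transGens V F) ↔ g • V ⊆ zeroSet (n := n) F := by
  simp only [transGens, mem_zeroSet_iff, Set.forall_mem_image2, evalAt_shift]
  constructor
  · intro h
    rintro _ ⟨v, hv, rfl⟩ f hf
    dsimp only
    rw [smul_eq_mul, mul_comm]
    exact h v hv f hf
  · intro h v hv f hf
    rw [mul_comm]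
    exact h ⟨v, hv, rfl⟩ f hf

/-! ### Images with the same fibres have the same size -/

/-- Two maps with the same fibres on a finite set have images of the same size. [folklore] -/
theorem ncard_image_eq_of_fibres {α β γ : Type*} {S : Set α} (hS : S.Finite) (f : α → β) (g : α → γ)
    (h : ∀ x ∈ S, ∀ y ∈ S, f x = f y ↔ g x = g y) : (f '' S).ncard = (g '' S).ncard := by
  classical
  have ef : f '' S = ↑(hS.toFinset.image f) := by rw [Finset.coe_image, hS.coe_toFinset]
  have eg : g '' S = ↑(hS.toFinset.image g) := by rw [Finset.coe_image, hS.coe_toFinset]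
  rw [ef, eg, Set.ncard_coe_finset, Set.ncard_coe_finset]
  rcases S.eq_empty_or_nonempty with hSe | ⟨x₀, hx₀⟩
  · subst hSe; simp
  haveI : Nonempty α := ⟨x₀⟩
  -- representatives
  have hrep : ∀ b ∈ hS.toFinset.image f, ∃ x ∈ S, f x = b := fun b hb => by
    obtain ⟨x, hx, rfl⟩ := Finset.mem_image.mp hb
    exact ⟨x, hS.mem_toFinset.mp hx, rfl⟩
  choose! rep hrepS hrepf using hrep
  refine Finset.card_bij (fun b _ => g (rep b)) (fun b hb => ?_) (fun b₁ hb₁ b₂ hb₂ heq => ?_) (fun c hc => ?_)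
  · exact Finset.mem_image.mpr ⟨rep b, hS.mem_toFinset.mpr (hrepS b hb), rfl⟩
  · have := (h _ (hrepS b₁ hb₁) _ (hrepS b₂ hb₂)).mpr heq
    rw [hrepf b₁ hb₁, hrepf b₂ hb₂] at this
    exact this
  · obtain ⟨y, hy, rfl⟩ := Finset.mem_image.mp hc
    have hyS := hS.mem_toFinset.mp hy
    refine ⟨f y, Finset.mem_image.mpr ⟨y, hy, rfl⟩, ?_⟩
    exact (h _ (hrepS _ (Finset.mem_image.mpr ⟨y, hy, rfl⟩)) _ hyS).mp (hrepf _ (Finset.mem_image.mpr ⟨y, hy, rfl⟩))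

end Descent

/-! ### The descent -/

/-- **Philippon's descent at `T = 0` on `𝔾ₐ × 𝔾ₘⁿ`** (Philippon 1986, §5 with Prop. 3.3 and
Lemme 4.5, case `G = 𝔾ₐ × 𝔾ₘⁿ ⊂ (ℙ¹)ⁿ⁺¹`, `cᵢ = 1`, `T = 0`). Let `D₀, D₁ ≥ 1`, `Σ ⊆ G(ℂ)` finite
with `e ∈ Σ`, and `P ≠ 0` a box polynomial of box degrees `(D₀, D₁)` vanishing on `Σ(n+1)`. Then
there is an irreducible closed subgroup `H₀` of `G(ℂ) = ℂ × (ℂˣ)ⁿ` which is a component of the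
zero set of a family of box polynomials of box degrees `(D₀, D₁)`, is contained in a translate of
`Z(P)`, and satisfies `card((Σ·H₀)/H₀) · mult_{D₀,D₁}(H₀) ≤ (n+1)! D₀ D₁ⁿ` (we count, as in the
printed theorem, the classes of `Σ` itself; the proof bounds the number of all the cosets of `H₀`
inside the transporter `E ⊇ Σ`, Philippon's `card S ≥ card((Σ + G_V)/G_V)`, p. 381 (∗∗∗)).
[cite: Philippon1986, Thm 2.1 (p. 358) and §5 (pp. 380–383), case T = 0, G = 𝔾ₐ × 𝔾ₘⁿ ⊂ (ℙ¹)ⁿ⁺¹] -/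
theorem exists_obstruction_subgroup {D₀ D₁ : ℕ} (hD₀ : 1 ≤ D₀) (hD₁ : 1 ≤ D₁) {S : Set (GaGm n)}
    (hS : S.Finite) (h1 : (1 : GaGm n) ∈ S) {P : MvPolynomial (Fin (n + 1)) ℂ} (hP0 : P ≠ 0)
    (hPB : P ∈ Box (n := n) D₀ D₁ 1) (hvan : ∀ g ∈ sumset S (n + 1), evalAt P g = 0) :
    ∃ (H₀ : Subgroup (GaGm n)) (_ : IsIrred (H₀ : Set (GaGm n))),
      (∃ (F : Set (MvPolynomial (Fin (n + 1)) ℂ)) (𝔮 : Ideal (MvPolynomial (Fin (n + 1)) ℂ)),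
        F ⊆ Box (n := n) D₀ D₁ 1 ∧ 𝔮 ∈ comps (zeroSet (n := n) F) ∧ (H₀ : Set (GaGm n)) = zeroSetI 𝔮) ∧
      (∃ g : GaGm n, ∀ h ∈ H₀, evalAt P (g * h) = 0) ∧
      Set.ncard ((QuotientGroup.mk : GaGm n → GaGm n ⧸ H₀) '' S) * mult D₀ D₁ (H₀ : Set (GaGm n)) ≤
        (n + 1).factorial * D₀ * D₁ ^ n := by
  classical
  -- the chain `Z_r`
  have hZcl : ∀ r, IsClosedG (Descent.Zs S P r) := Descent.isClosedG_Zs S P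
  have h1Z : ∀ r, r ≤ n + 1 → (1 : GaGm n) ∈ Descent.Zs S P r := fun r hr =>
    Descent.Zs_antitone h1 P hr (Descent.one_mem_Zs hvan)
  have hZne : ∀ r, r ≤ n + 1 → (Descent.Zs S P r).Nonempty := fun r hr => ⟨1, h1Z r hr⟩
  -- `dim Z_0 ≤ n`
  have hd0 : dimG (Descent.Zs S P 0) ≤ n := by
    have hne : Descent.Zs S P 0 ≠ Set.univ := by
      intro h
      apply hP0
      have : P ∈ vanishing (Set.univ : Set (GaGm n)) := fun g _ => by
        have hg : g ∈ Descent.Zs S P 0 := h ▸ Set.mem_univ g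
        exact Descent.mem_Zs_zero_iff.mp hg
      rwa [vanishing_univ, Submodule.mem_bot] at this
    have hlt := dimG_lt_of_ssubset isIrred_univ (hZcl 0) (hZne 0 (Nat.zero_le _))
      (Set.ssubset_univ_iff.mpr hne)
    rw [dimG_univ] at hlt
    omega
  -- pigeonhole: `dim Z_r = dim Z_{r+1}`
  obtain ⟨r, hrn, hdr⟩ := Descent.exists_eq_succ_of_antitone (d := fun r => dimG (Descent.Zs S P r))
    (fun r => dimG_mono (Descent.Zs_succ_subset h1 P r)) hd0
  -- a top-dimensional component `V` of `Z_{r+1}`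
  obtain ⟨𝔮ᵥ, h𝔮ᵥ, hdimV⟩ := exists_minimalPrimes_dimG_eq (hZne (r + 1) (by omega))
  obtain ⟨hV, -, hVsub⟩ := isIrred_zeroSet_of_mem_minimalPrimes h𝔮ᵥ
  rw [(hZcl (r + 1)).eq] at hVsub
  generalize hVgen : zeroSet (n := n) (↑𝔮ᵥ : Set (MvPolynomial (Fin (n + 1)) ℂ)) = V at hV hVsub hdimV
  -- the stabiliser `St` of `V` and its identity component `G'`
  have hStcl : IsClosedG ((MulAction.stabilizer (GaGm n) V : Subgroup (GaGm n)) : Set (GaGm n)) :=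
    Descent.isClosedG_stabilizer hV
  have hG'irr : IsIrred ((idComp (MulAction.stabilizer (GaGm n) V) hStcl : Subgroup (GaGm n)) : Set (GaGm n)) :=
    isIrred_idComp _ hStcl
  have hG'St : idComp (MulAction.stabilizer (GaGm n) V) hStcl ≤ MulAction.stabilizer (GaGm n) V := idComp_le _ hStcl
  obtain ⟨T, -, hStT⟩ := exists_finset_eq_biUnion_smul_idComp (MulAction.stabilizer (GaGm n) V) hStcl
  generalize hG'gen : idComp (MulAction.stabilizer (GaGm n) V) hStcl = G' at hG'irr hG'St hStT
  -- the transporter `E = {g ; gV ⊆ Z_r} = Z(J)`, `J` box polynomials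
  have hJB : Descent.transGens V (Descent.gens S P r) ⊆ Box (n := n) D₀ D₁ 1 :=
    Descent.transGens_subset_Box (Descent.gens_subset_Box hPB r)
  generalize hJgen : Descent.transGens V (Descent.gens S P r) = J at hJB
  have hmemE : ∀ g, g ∈ zeroSet (n := n) J ↔ g • V ⊆ Descent.Zs S P r := fun g => by
    rw [← hJgen]; exact Descent.mem_zeroSet_transGens_iff
  generalize hEgen : zeroSet (n := n) J = E at hmemE
  have hEJ : E = zeroSet (n := n) J := hEgen.symm
  have hEcl : IsClosedG E := by rw [hEJ]; exact isClosedG_zeroSet _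
  have hSE : S ⊆ E := fun σ hσ => (hmemE σ).mpr
    ((Set.smul_set_mono hVsub).trans (Descent.smul_Zs_succ_subset hσ P r))
  have h1E : (1 : GaGm n) ∈ E := hSE h1
  -- `E · St ⊆ E`, hence cosets of `G'` through points of `E` lie in `E`
  have hESt : ∀ g ∈ E, ∀ s ∈ MulAction.stabilizer (GaGm n) V, g * s ∈ E := fun g hg s hs => by
    rw [hmemE, mul_smul, MulAction.mem_stabilizer_iff.mp hs]
    exact (hmemE g).mp hg
  have hcosE : ∀ g ∈ E, g • ((G' : Subgroup (GaGm n)) : Set (GaGm n)) ⊆ E := by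
    rintro g hg _ ⟨h, hh, rfl⟩
    exact hESt g hg h (hG'St hh)
  -- `E`-translates of `V` are top-dimensional components of `Z_r`
  have htrans : ∀ c ∈ E, ∃ 𝔮 ∈ (vanishing (Descent.Zs S P r)).minimalPrimes,
      c • V = zeroSet (n := n) ↑𝔮 := fun c hc =>
    (hV.smul c).exists_eq_zeroSet_minimalPrimes (hZcl r) ((hmemE c).mp hc)
      (by rw [dimG_smul, hdimV]; exact hdr.symm)
  -- finitely many `St`-cosets cover `E`
  have hcover : ∃ C : Finset (GaGm n),
      E ⊆ ⋃ c ∈ C, c • ((MulAction.stabilizer (GaGm n) V : Subgroup (GaGm n)) : Set (GaGm n)) := by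
    have hpick : ∀ 𝔮 : Ideal (MvPolynomial (Fin (n + 1)) ℂ), ∃ c : GaGm n,
        (∃ c' ∈ E, c' • V = zeroSet (n := n) ↑𝔮) → c • V = zeroSet (n := n) ↑𝔮 := by
      intro 𝔮
      by_cases h : ∃ c' ∈ E, c' • V = zeroSet (n := n) ↑𝔮
      · obtain ⟨c', -, h'⟩ := h; exact ⟨c', fun _ => h'⟩
      · exact ⟨1, fun h' => absurd h' h⟩
    choose pick hpick using hpick
    refine ⟨(comps (Descent.Zs S P r)).image pick, fun c hc => ?_⟩
    obtain ⟨𝔮, h𝔮, hc𝔮⟩ := htrans c hc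
    have hp := hpick 𝔮 ⟨c, hc, hc𝔮⟩
    rw [Set.mem_iUnion₂]
    refine ⟨pick 𝔮, Finset.mem_image_of_mem _ (mem_comps.mpr h𝔮), (pick 𝔮)⁻¹ * c, ?_, by simp [smul_eq_mul]⟩
    have : ((pick 𝔮)⁻¹ * c) • V = V := by rw [mul_smul, hc𝔮, ← hp, inv_smul_smul]
    exact MulAction.mem_stabilizer_iff.mpr this
  obtain ⟨C, hEC⟩ := hcover
  -- `dim E ≤ dim G'`
  have hdimE : dimG E ≤ dimG ((G' : Subgroup (GaGm n)) : Set (GaGm n)) := by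
    obtain ⟨𝔯, h𝔯, hdim𝔯⟩ := exists_minimalPrimes_dimG_eq (X := E) ⟨1, h1E⟩
    obtain ⟨h𝔯irr, -, h𝔯sub⟩ := isIrred_zeroSet_of_mem_minimalPrimes h𝔯
    rw [hEcl.eq] at h𝔯sub
    have hsub : zeroSet (n := n) ↑𝔯 ⊆
        ⋃ p ∈ C ×ˢ T, (p.1 * p.2) • ((G' : Subgroup (GaGm n)) : Set (GaGm n)) := by
      intro g hg
      obtain ⟨c, hc, hgc⟩ := Set.mem_iUnion₂.mp (hEC (h𝔯sub hg))
      obtain ⟨s, hs, rfl⟩ := hgc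
      have hsSt : s ∈ ((MulAction.stabilizer (GaGm n) V : Subgroup (GaGm n)) : Set (GaGm n)) := hs
      rw [hStT] at hsSt
      obtain ⟨a, ha, hsa⟩ := Set.mem_iUnion₂.mp hsSt
      obtain ⟨g', hg', rfl⟩ := hsa
      rw [Set.mem_iUnion₂]
      exact ⟨(c, a), Finset.mem_product.mpr ⟨hc, ha⟩, g', hg', by simp [smul_eq_mul, mul_assoc]⟩
    obtain ⟨p, -, hp⟩ := h𝔯irr.exists_subset_of_subset_biUnion (C ×ˢ T) _
      (fun p _ => (hG'irr.isClosedG).smul _) hsub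
    rw [← hdim𝔯]
    exact (dimG_mono hp).trans (dimG_smul _ _).le
  -- every coset `σ G'`, `σ ∈ S`, is a top-dimensional component of `E`
  have hcomp : ∀ σ ∈ S, ∃ 𝔮 ∈ (comps E).filter (fun 𝔮 => dimG (zeroSetI (n := n) 𝔮) = dimG E),
      zeroSetI (n := n) 𝔮 = σ • ((G' : Subgroup (GaGm n)) : Set (GaGm n)) := by
    intro σ hσ
    have hsub := hcosE σ (hSE hσ)
    have hdim : dimG (σ • ((G' : Subgroup (GaGm n)) : Set (GaGm n))) = dimG E :=
      le_antisymm (dimG_mono hsub) (hdimE.trans (dimG_smul σ _).symm.le)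
    obtain ⟨𝔮, h𝔮, heq⟩ := (hG'irr.smul σ).exists_eq_zeroSet_minimalPrimes hEcl hsub hdim
    refine ⟨𝔮, Finset.mem_filter.mpr ⟨mem_comps.mpr h𝔮, ?_⟩, heq.symm⟩
    change dimG (zeroSet (n := n) ↑𝔮) = dimG E
    rw [← heq, hdim]
  -- the count: distinct cosets `σ G'` ↔ distinct classes in `G/G'`
  have hfib : ∀ x ∈ S, ∀ y ∈ S, (QuotientGroup.mk x : GaGm n ⧸ G') = QuotientGroup.mk y ↔
      x • ((G' : Subgroup (GaGm n)) : Set (GaGm n)) = y • ((G' : Subgroup (GaGm n)) : Set (GaGm n)) := by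
    intro x _ y _
    rw [QuotientGroup.eq, leftCoset_eq_iff]
  have hncard : Set.ncard ((QuotientGroup.mk : GaGm n → GaGm n ⧸ G') '' S) =
      (hS.toFinset.image fun σ => σ • ((G' : Subgroup (GaGm n)) : Set (GaGm n))).card := by
    rw [Descent.ncard_image_eq_of_fibres hS _ (fun σ => σ • ((G' : Subgroup (GaGm n)) : Set (GaGm n))) hfib,
      show (fun σ => σ • ((G' : Subgroup (GaGm n)) : Set (GaGm n))) '' S =
        ↑(hS.toFinset.image fun σ => σ • ((G' : Subgroup (GaGm n)) : Set (GaGm n))) by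
          rw [Finset.coe_image, hS.coe_toFinset],
      Set.ncard_coe_finset]
  -- the prime of each coset
  have hprime : ∀ Y ∈ hS.toFinset.image (fun σ => σ • ((G' : Subgroup (GaGm n)) : Set (GaGm n))),
      ∃ 𝔮 ∈ (comps E).filter (fun 𝔮 => dimG (zeroSetI (n := n) 𝔮) = dimG E), zeroSetI (n := n) 𝔮 = Y := by
    intro Y hY
    obtain ⟨σ, hσ, rfl⟩ := Finset.mem_image.mp hY
    exact hcomp σ (hS.mem_toFinset.mp hσ)
  choose! ψ hψmem hψeq using hprime
  have hψinj : Set.InjOn ψ ↑(hS.toFinset.image (fun σ => σ • ((G' : Subgroup (GaGm n)) : Set (GaGm n)))) := by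
    intro Y hY Y' hY' h
    rw [← hψeq Y hY, ← hψeq Y' hY', h]
  have hsum : ∑ Y ∈ hS.toFinset.image (fun σ => σ • ((G' : Subgroup (GaGm n)) : Set (GaGm n))),
      mult D₀ D₁ Y ≤ (n + 1).factorial * D₀ * D₁ ^ n := by
    calc ∑ Y ∈ hS.toFinset.image (fun σ => σ • ((G' : Subgroup (GaGm n)) : Set (GaGm n))), mult D₀ D₁ Y
        = ∑ Y ∈ hS.toFinset.image (fun σ => σ • ((G' : Subgroup (GaGm n)) : Set (GaGm n))),
            mult D₀ D₁ (zeroSetI (n := n) (ψ Y)) :=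
          Finset.sum_congr rfl fun Y hY => by rw [hψeq Y hY]
      _ = ∑ 𝔮 ∈ (hS.toFinset.image (fun σ => σ • ((G' : Subgroup (GaGm n)) : Set (GaGm n)))).image ψ,
            mult D₀ D₁ (zeroSetI (n := n) 𝔮) :=
          (Finset.sum_image (f := fun 𝔮 => mult D₀ D₁ (zeroSetI (n := n) 𝔮)) hψinj).symm
      _ ≤ ∑ 𝔮 ∈ (comps E).filter (fun 𝔮 => dimG (zeroSetI (n := n) 𝔮) = dimG E),
            mult D₀ D₁ (zeroSetI (n := n) 𝔮) :=
          Finset.sum_le_sum_of_subset_of_nonneg (fun 𝔮 h𝔮 => by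
            obtain ⟨Y, hY, rfl⟩ := Finset.mem_image.mp h𝔮; exact hψmem Y hY) (fun _ _ _ => Nat.zero_le _)
      _ ≤ (n + 1).factorial * D₀ * D₁ ^ n := by
          rw [hEJ]; exact sum_mult_le_of_subset_Box hD₀ hD₁ hJB ⟨1, hEJ ▸ h1E⟩
  have hconst : ∀ Y ∈ hS.toFinset.image (fun σ => σ • ((G' : Subgroup (GaGm n)) : Set (GaGm n))),
      mult D₀ D₁ Y = mult D₀ D₁ ((G' : Subgroup (GaGm n)) : Set (GaGm n)) := by
    intro Y hY
    obtain ⟨σ, -, rfl⟩ := Finset.mem_image.mp hY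
    exact mult_smul hD₀ hD₁ hG'irr σ
  rw [Finset.sum_congr rfl hconst, Finset.sum_const, smul_eq_mul] at hsum
  -- assemble
  obtain ⟨v₀, hv₀⟩ := hV.nonempty
  obtain ⟨𝔮₁, h𝔮₁, h𝔮₁eq⟩ := hcomp 1 h1
  refine ⟨G', hG'irr, ⟨J, 𝔮₁, hJB, ?_, by rw [h𝔮₁eq, one_smul]⟩, ⟨v₀, fun h hh => ?_⟩, ?_⟩
  · rw [← hEJ]; exact (Finset.mem_filter.mp h𝔮₁).1
  · -- `v₀ h = h v₀ ∈ hV = V ⊆ Z_{r+1} ⊆ Z_0 = Z(P)`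
    have hhSt : h • V = V := MulAction.mem_stabilizer_iff.mp (hG'St hh)
    have hmem : v₀ * h ∈ V := by rw [mul_comm, ← hhSt]; exact Set.smul_mem_smul_set hv₀
    exact Descent.mem_Zs_zero_iff.mp (Descent.Zs_antitone h1 P (Nat.zero_le (r + 1)) (hVsub hmem))
  · rw [hncard]; exact hsum

end GaGm

end Literature.NumberTheory.Transcendental
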